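import Summits.AnomalousDissipation.AnomalousDissipation.Theorems.WazewskiBlockPointwiseFloorToSummit

/-!
# Route WazewskiBlock (AnomalousDissipation) — `Assembly`

Settles stmt-AnomalousDissipation-1738:
`Assembly := UniformGalerkinTrap → GalerkinTrapToLerayHopf → EnstrophyCapNoLeakage →
AnomalousDissipation`.

The proof is the composition of two steps.

* Glue (`wazewskiBlockTrapToPointwiseFloor_proof`, whose type is literally the route decl
  `TrapToPointwiseFloor`, item stmt-AnomalousDissipation-14362): from the crux
  `UniformGalerkinTrap` take the force `f`
  (a mean-zero divergence-free vector trigonometric polynomial) and the constants `E`, `ε₀`,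
  `ν₀`; put `ν j := ν₀ / (j + 1) ∈ (0, ν₀]`, so `ν j → 0`; for each `j` the crux supplies an
  enstrophy level `G j`, an order `N₀ j` and, for every `N ≥ N₀ j`, a global Galerkin trajectory
  of order `N` trapped in `{kineticEnergy ≤ E} ∩ {(f, ·) ≥ ε₀} ∩ {eGradNormSq ≤ G j}` — verbatim
  the premise of `GalerkinTrapToLerayHopf`, which returns a global Leray–Hopf solution `u j`
  (datum `u₀ j`) of `NS_{ν j}` with the same three pointwise bounds for `t ≥ 0`; and
  `EnstrophyCapNoLeakage` turns the energy and enstrophy caps into the no-leakage clause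
  `⟨(f, u j)⟩ ≤ meanDissipation (ν j) (u j)`. Choosing over `j` gives `PointwiseFloorFamily`.
* Frame (`pointwiseFloorToSummit_proof`, in tree): `PointwiseFloorFamily → AnomalousDissipation`
  (Cesàro bookkeeping: `meanEnergy ≤ 2E`, `meanDissipation ≥ ⟨(f, u j)⟩ ≥ ε₀`).
-/

noncomputable section

open MeasureTheory Set Filter Topology
open scoped InnerProductSpace RealInnerProductSpace

namespace Summit.AnomalousDissipation.AnomalousDissipation.Theorems

-- D-0017: single-problem summit ⇒ `Summit.AnomalousDissipation.AnomalousDissipation.…` by design.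
set_option linter.dupNamespace false

open Literature.Analysis.FluidPDE Literature.Analysis.FunctionSpaces
open Summit.AnomalousDissipation.AnomalousDissipation.Theses.WazewskiBlock

/-- Settles the glue item stmt-AnomalousDissipation-14362 of route `WazewskiBlock`:
`UniformGalerkinTrap → GalerkinTrapToLerayHopf → EnstrophyCapNoLeakage → PointwiseFloorFamily`.
Take `(m, f, E, ε₀, ν₀)` from the crux; `ν j := ν₀ / (j + 1)` lies in `(0, ν₀]` and tends to `0`;
for each `j` the crux gives `G j`, `N₀ j` and trapped Galerkin trajectories for all `N ≥ N₀ j`,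
`GalerkinTrapToLerayHopf` gives a global Leray–Hopf solution with the three pointwise bounds, and
`EnstrophyCapNoLeakage` (with `IsSmooth f`, the first conjunct of the force clause) gives the
no-leakage clause; `choose` over `j`. -/
theorem wazewskiBlockTrapToPointwiseFloor_proof :
    Summit.AnomalousDissipation.AnomalousDissipation.Theses.WazewskiBlock.TrapToPointwiseFloor := by
  unfold TrapToPointwiseFloor UniformGalerkinTrap GalerkinTrapToLerayHopf EnstrophyCapNoLeakage
    PointwiseFloorFamily
  rintro ⟨m, f, hfm, hmean, E, ε₀, ν₀, hε₀, hν₀, htrap⟩ hLim hCap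
  -- the viscosity sequence `ν j := ν₀ / (j + 1)`
  have hνpos : ∀ j : ℕ, 0 < ν₀ / ((j : ℝ) + 1) := fun j => div_pos hν₀ (by positivity)
  have hνle : ∀ j : ℕ, ν₀ / ((j : ℝ) + 1) ≤ ν₀ := fun j =>
    div_le_self hν₀.le (le_add_of_nonneg_left (Nat.cast_nonneg j))
  have hνlim : Tendsto (fun j : ℕ => ν₀ / ((j : ℝ) + 1)) atTop (nhds 0) := by
    have h := (tendsto_one_div_add_atTop_nhds_zero_nat).const_mul ν₀
    rw [mul_zero] at h
    refine h.congr fun j => ?_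
    rw [mul_one_div]
  -- one Leray–Hopf solution per viscosity, with the three pointwise bounds
  have key : ∀ j : ℕ, ∃ (G : NNReal) (u₀ : UnitAddTorus (Fin 3) → EuclideanSpace ℝ (Fin 3))
      (u : ℝ → UnitAddTorus (Fin 3) → EuclideanSpace ℝ (Fin 3)),
      Torus.IsGlobalLerayHopf (ν₀ / ((j : ℝ) + 1)) (fun _ => f) u₀ u ∧
        ∀ t : ℝ, 0 ≤ t → Torus.kineticEnergy (u t) ≤ E ∧ ε₀ ≤ (∫ x, ⟪f x, u t x⟫_ℝ) ∧
          Torus.eGradNormSq (u t) ≤ (G : ENNReal) := by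
    intro j
    obtain ⟨G, N₀, hN⟩ := htrap _ (hνpos j) (hνle j)
    obtain ⟨u₀, u, hLH, hb⟩ := hLim _ m N₀ f E ε₀ G (hνpos j) hfm hmean hN
    exact ⟨G, u₀, u, hLH, hb⟩
  choose G u₀ u hLH hb using key
  refine ⟨f, hfm.1, hfm.2.1, hmean, fun j => ν₀ / ((j : ℝ) + 1), u₀, u, hνpos, hνlim, hLH, E, ε₀,
    hε₀, fun j t ht => ⟨(hb j t ht).1, (hb j t ht).2.1⟩, fun j => ?_⟩
  exact hCap _ f (u₀ j) (u j) E (G j) (hνpos j) hfm.1 (hLH j)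
    (fun t ht => ⟨(hb j t ht).1, (hb j t ht).2.2⟩)

/-- Settles stmt-AnomalousDissipation-1738 (route `WazewskiBlock`, the assembly):
`UniformGalerkinTrap → GalerkinTrapToLerayHopf → EnstrophyCapNoLeakage → AnomalousDissipation`,
as the frame `pointwiseFloorToSummit_proof : PointwiseFloorFamily → AnomalousDissipation`
composed with the glue `wazewskiBlockTrapToPointwiseFloor_proof`. -/
theorem wazewskiBlockAssembly_proof :
    Summit.AnomalousDissipation.AnomalousDissipation.Theses.WazewskiBlock.Assembly := by
  unfold Assembly
  intro hTrap hLim hCap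
  exact pointwiseFloorToSummit_proof (wazewskiBlockTrapToPointwiseFloor_proof hTrap hLim hCap)

end Summit.AnomalousDissipation.AnomalousDissipation.Theorems

end
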